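import Summits.Ventures.LatticeQCDFlow.Scaling.ExtensiveSpecificHeat
import Summits.Ventures.LatticeQCDFlow.TrivializingMaps.WilsonVarianceFloorAllCouplings

/-!
HONEST FRAMING: exact (Metropolis-corrected) sampling algorithms for lattice gauge theory; figures
of merit are autocorrelation/cost numbers at stated couplings and volumes; no continuum-physics
claim.

# WilsonFisherZerosAllCouplingsSharp — THE ALL-COUPLING COROLLARIES WITH theory2's RATE `e^{-8N(d−1)|β|}`:
# A FISHER ZERO WITHIN `4N(n+2)²3^{n+1}e^{8N(n+1)|β|}/Var_Haar(Re tr ρ)` OF EVERY REAL `β` IN EVERY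
# VOLUME, AND THE REWEIGHTING / ANNEALING LAWS AT EVERY COUPLING, FOR EVERY CONTINUOUS `ρ`
# (lean-2 GEN-9, ours; docking of theory2 item 126, custody-landed by this seat)

Venture-side (OURS).  Cell `lqcd-flow` (pub-lqcd), unit `pub-lqcd-lean-2-g9`, 2026-08-23.  The corollaries of
`WilsonVarianceFloorAllCouplings` §2–§3 re-derived from theory2's sharper floor
`Theory2.ExtensiveSpecificHeat.wilson_variance_ge_extensive` (item 126, GEN-39; in the tree as
`Scaling/ExtensiveSpecificHeat`): on `(ℤ/L)^{n+2}`, `L ≥ 2`, every compact second-countable `G`, every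
CONTINUOUS `ρ` (no unitarity needed) and every real `β`,
`L·⌊L/2⌋^{n+1}·e^{-8N(n+1)|β|}·Var_Haar(Re tr ρ) ≤ Var_{μ_β}(S_W)`.  Hence (`d = n + 2`):

* **`wilson_exists_fisherZero_near_allCouplings_sharp`** — if `Var_Haar(Re tr ρ) > 0`, for every real `β`
  and every `L ≥ 2` the partition function `Z_L(s) = ∫ D[U] e^{-sS_W}` has a zero `s₀` with
  `|s₀ − β| ≤ 4N·(n+2)²·3^{n+1}·e^{8N(n+1)|β|} / Var_Haar(Re tr ρ)` — VOLUME-INDEPENDENT (GEN-7's radius law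
  `dist(β, zeros) ≤ 4·half-range/Var_β` + `#plaq ≤ (n+2)²L^{n+2} ≤ (n+2)²3^{n+1}·L⌊L/2⌋^{n+1}`);
* **`wilson_weight_sq_ge_exp_allCouplings_sharp`** — one exact reweighting step `β → β+δ` (`δ ≥ 0`) has
  `E_{μ_β}[w²] ≥ exp(δ²·e^{-8N(n+1)M}·L⌊L/2⌋^{n+1}·Var_Haar(Re tr ρ))`, `M = max |β| |β+2δ|`;
* **`wilson_schedule_cost_ge_allCouplings_sharp`** — a `k`-step schedule inside `[−M, M]` costs
  `≥ e^{-8N(n+1)M}·L⌊L/2⌋^{n+1}·Var_Haar(Re tr ρ)·(β_k − β_0)²/k`.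

NOT CLAIMED: anything beyond `WilsonVarianceFloorAllCouplings`' NOT-CLAIMED list; the rate `8N(n+1)` is
theory2's and is not claimed optimal (the truth at weak coupling is polynomial in `β`).  Literature grade
(cell rule): corollaries; new typing only.
-/

noncomputable section

open MeasureTheory ProbabilityTheory Filter Topology Set
open Literature.MathematicalPhysics.QuantumFieldTheory
open Literature.MathematicalPhysics.QuantumFieldTheory.Luscher2010
open Summit.Ventures.LatticeQCDFlow.Theory2.ExtensiveSpecificHeat (wilson_variance_ge_extensive)

namespace Summit.Ventures.LatticeQCDFlow.TrivializingMaps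

variable {n L N : ℕ} [NeZero L] {G : Type*} [Group G] [TopologicalSpace G] [IsTopologicalGroup G]
  [CompactSpace G] [MeasurableSpace G] [BorelSpace G] [SecondCountableTopology G]
  (ρ : G →* Matrix (Fin N) (Fin N) ℂ)

/-- `#plaquettes ≤ (n+2)²·3^{n+1}·(L·⌊L/2⌋^{n+1})` on `(ℤ/L)^{n+2}`, `L ≥ 2`. [folklore] -/
theorem card_plaquette_le_mul_evenCount (hL : 2 ≤ L) :
    (Fintype.card (Plaquette (n + 2) L) : ℝ) ≤
      (((n + 2) ^ 2 * 3 ^ (n + 1) : ℕ) : ℝ) * ((L * (L / 2) ^ (n + 1) : ℕ) : ℝ) := by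
  have h1 := LatticeForm.card_plaquette_le (d := n + 2) (L := L)
  have h2 : L ^ (n + 1) ≤ 3 ^ (n + 1) * (L / 2) ^ (n + 1) := by
    rw [← mul_pow]; exact Nat.pow_le_pow_left (by omega) _
  have h3 : Fintype.card (Plaquette (n + 2) L) ≤ (n + 2) ^ 2 * 3 ^ (n + 1) * (L * (L / 2) ^ (n + 1)) := by
    calc Fintype.card (Plaquette (n + 2) L) ≤ (n + 2) ^ 2 * L ^ (n + 2) := h1
      _ = (n + 2) ^ 2 * (L * L ^ (n + 1)) := by rw [← pow_succ']
      _ ≤ (n + 2) ^ 2 * (L * (3 ^ (n + 1) * (L / 2) ^ (n + 1))) :=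
          Nat.mul_le_mul_left _ (Nat.mul_le_mul_left _ h2)
      _ = (n + 2) ^ 2 * 3 ^ (n + 1) * (L * (L / 2) ^ (n + 1)) := by ring
  exact_mod_cast h3

/-- **FISHER ZEROS NEAR EVERY REAL COUPLING, UNIFORMLY IN THE VOLUME, WITH THE RATE `e^{8N(n+1)|β|}`.**  For
`G` compact second countable, `ρ` continuous with `Var_Haar(Re tr ρ) > 0`, every `L ≥ 2` and every real
`β`, the `(n+2)`-dimensional Wilson partition function `Z_L(s) = ∫ D[U] e^{-sS_W}` has a zero `s₀` with
`|s₀ − β| ≤ 4N·(n+2)²·3^{n+1}·e^{8N(n+1)|β|} / Var_Haar(Re tr ρ)`. [ours] -/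
theorem wilson_exists_fisherZero_near_allCouplings_sharp (hL : 2 ≤ L) (hρ : Continuous ρ)
    (hv : 0 < variance (fun g => (ρ g).trace.re) (haarProbability G)) (β : ℝ) :
    ∃ s₀ : ℂ, ‖s₀ - β‖ ≤ 4 * N * (((n + 2) ^ 2 * 3 ^ (n + 1) : ℕ) : ℝ) *
        Real.exp (8 * N * (n + 1) * |β|) / variance (fun g => (ρ g).trace.re) (haarProbability G) ∧
      complexMGF (fun U => -wilsonAction ρ U) (trivialMeasure G (n + 2) L) s₀ = 0 := by
  classical
  set D := trivialMeasure G (n + 2) L with hD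
  set v : ℝ := variance (fun g => (ρ g).trace.re) (haarProbability G) with hvdef
  set P : ℝ := (Fintype.card (Plaquette (n + 2) L) : ℝ) with hP
  set E : ℝ := ((L * (L / 2) ^ (n + 1) : ℕ) : ℝ) with hE
  haveI : IsProbabilityMeasure D := trivialMeasure_isProbabilityMeasure
  have hfloor := wilson_variance_ge_extensive (n := n) (L := L) ρ hL hρ β
  rw [← hvdef, ← hE] at hfloor
  have hE1 : (1 : ℝ) ≤ E := by
    rw [hE]
    have : 1 ≤ L * (L / 2) ^ (n + 1) := Nat.one_le_iff_ne_zero.2 (Nat.mul_ne_zero (by omega)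
      (pow_ne_zero _ (by omega)))
    exact_mod_cast this
  have hfloorpos : 0 < E * Real.exp (-(8 * N * (n + 1) * |β|)) * v := by positivity
  have hvarpos : 0 < variance (wilsonAction (d := n + 2) (L := L) ρ)
      (wilsonMeasure (d := n + 2) (L := L) ρ β) := lt_of_lt_of_le hfloorpos hfloor
  have hm : AEMeasurable (fun U => -wilsonAction ρ U) D :=
    (WilsonRP.measurable_wilsonAction ρ hρ).neg.aemeasurable
  have hb : ∀ᵐ U ∂D, |(-wilsonAction ρ U) - (-((N : ℝ) * P))| ≤ (N : ℝ) * P :=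
    ae_of_all _ fun U => by
      have h0 := WilsonPinching.wilsonAction_nonneg ρ hρ U
      have h1 := WilsonPinching.wilsonAction_le ρ hρ U
      rw [abs_le, hP]
      constructor <;> linarith
  have hVt : variance (fun U => -wilsonAction ρ U) (D.tilted fun U => β * (-wilsonAction ρ U)) =
      variance (wilsonAction (d := n + 2) (L := L) ρ) (wilsonMeasure (d := n + 2) (L := L) ρ β) := by
    rw [hD, ← wilsonMeasure_eq_tilted_neg ρ hρ β, variance_fun_neg]
  have hvar' : 0 < variance (fun U => -wilsonAction ρ U) (D.tilted fun U => β * (-wilsonAction ρ U)) := by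
    rw [hVt]; exact hvarpos
  obtain ⟨s₀, hs₀, hz⟩ := exists_zero_near_norm_le_of_variance_tilted_pos hm hb β hvar'
  refine ⟨s₀, hs₀.trans ?_, hz⟩
  rw [hVt, abs_of_nonneg (by positivity)]
  have hPle : P ≤ (((n + 2) ^ 2 * 3 ^ (n + 1) : ℕ) : ℝ) * E := by
    rw [hP, hE]; exact card_plaquette_le_mul_evenCount (n := n) hL
  calc 4 * ((N : ℝ) * P) / variance (wilsonAction (d := n + 2) (L := L) ρ) (wilsonMeasure (d := n + 2) (L := L) ρ β)
      ≤ 4 * ((N : ℝ) * P) / (E * Real.exp (-(8 * N * (n + 1) * |β|)) * v) :=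
        div_le_div_of_nonneg_left (by positivity) hfloorpos hfloor
    _ ≤ 4 * ((N : ℝ) * ((((n + 2) ^ 2 * 3 ^ (n + 1) : ℕ) : ℝ) * E)) /
          (E * Real.exp (-(8 * N * (n + 1) * |β|)) * v) := by gcongr
    _ = 4 * N * (((n + 2) ^ 2 * 3 ^ (n + 1) : ℕ) : ℝ) * Real.exp (8 * N * (n + 1) * |β|) / v := by
        rw [Real.exp_neg]
        have hx : Real.exp (8 * N * (n + 1) * |β|) ≠ 0 := (Real.exp_pos _).ne'
        have hE0 : E ≠ 0 := by positivity
        field_simp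

/-- **ONE EXACT REWEIGHTING STEP AT ANY COUPLING, theory2's RATE**: for `δ ≥ 0`, `M = max |β| |β+2δ|`,
`E_{μ_β}[w²] ≥ exp(δ² · e^{-8N(n+1)M} · L⌊L/2⌋^{n+1} · Var_Haar(Re tr ρ))` (every `L ≥ 2`, every continuous
`ρ`, every compact `G`). [ours] -/
theorem wilson_weight_sq_ge_exp_allCouplings_sharp (hL : 2 ≤ L) (hρ : Continuous ρ) {β δ : ℝ}
    (hδ : 0 ≤ δ) :
    Real.exp (δ ^ 2 * (((L * (L / 2) ^ (n + 1) : ℕ) : ℝ) *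
        Real.exp (-(8 * N * (n + 1) * max |β| |β + 2 * δ|)) *
        variance (fun g => (ρ g).trace.re) (haarProbability G))) ≤
      ∫ U, (Real.exp (-(δ * wilsonAction ρ U)) *
        (mgf (fun U => -wilsonAction ρ U) (trivialMeasure G (n + 2) L) β /
          mgf (fun U => -wilsonAction ρ U) (trivialMeasure G (n + 2) L) (β + δ))) ^ 2
      ∂(wilsonMeasure (d := n + 2) (L := L) ρ β) := by
  classical
  refine weight_sq_integral_ge_exp_anyGroup (d := n + 2) (L := L) hρ hδ fun u hu => ?_
  refine le_trans ?_ (wilson_variance_ge_extensive (n := n) (L := L) ρ hL hρ u)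
  have hv : 0 ≤ variance (fun g => (ρ g).trace.re) (haarProbability G) := variance_nonneg _ _
  have hu' : |u| ≤ max |β| |β + 2 * δ| := by
    rw [abs_le]
    constructor
    · have := neg_abs_le β
      have := le_max_left |β| |β + 2 * δ|
      linarith [hu.1]
    · have := le_abs_self (β + 2 * δ)
      have := le_max_right |β| |β + 2 * δ|
      linarith [hu.2]
  have hN : (0 : ℝ) ≤ 8 * N * (n + 1) := by positivity
  have hexp : Real.exp (-(8 * N * (n + 1) * max |β| |β + 2 * δ|)) ≤ Real.exp (-(8 * N * (n + 1) * |u|)) :=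
    Real.exp_le_exp.2 (by nlinarith)
  have hE : (0 : ℝ) ≤ ((L * (L / 2) ^ (n + 1) : ℕ) : ℝ) := by positivity
  exact mul_le_mul_of_nonneg_right (mul_le_mul_of_nonneg_left hexp hE) hv

/-- **THE ANNEALING COST LAW AT EVERY COUPLING, theory2's RATE**: a `k`-step schedule `β_{i+1} = β_i + δ_i`
(`0 ≤ δ_i ≤ D`, `k ≥ 1`, `[β_0, β_k + D] ⊆ [−M, M]`) has
`∑_i (ψ(β_i+2δ_i) − 2ψ(β_i+δ_i) + ψ(β_i)) ≥ e^{-8N(n+1)M}·L⌊L/2⌋^{n+1}·Var_Haar(Re tr ρ)·(β_k − β_0)²/k`,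
`ψ = cgf(−S_W)`. [ours] -/
theorem wilson_schedule_cost_ge_allCouplings_sharp (hL : 2 ≤ L) (hρ : Continuous ρ) {k : ℕ} (hk : 1 ≤ k)
    (β δ : ℕ → ℝ) (hstep : ∀ i, β (i + 1) = β i + δ i) (hδ : ∀ i < k, 0 ≤ δ i) {D M : ℝ}
    (hD : ∀ i < k, δ i ≤ D) (hlo : -M ≤ β 0) (hhi : β k + D ≤ M) :
    ((L * (L / 2) ^ (n + 1) : ℕ) : ℝ) * Real.exp (-(8 * N * (n + 1) * M)) *
        variance (fun g => (ρ g).trace.re) (haarProbability G) * (β k - β 0) ^ 2 / k ≤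
      ∑ i ∈ Finset.range k,
        (cgf (fun U => -wilsonAction ρ U) (trivialMeasure G (n + 2) L) (β i + 2 * δ i) -
          2 * cgf (fun U => -wilsonAction ρ U) (trivialMeasure G (n + 2) L) (β i + δ i) +
          cgf (fun U => -wilsonAction ρ U) (trivialMeasure G (n + 2) L) (β i)) := by
  classical
  set m : ℝ := ((L * (L / 2) ^ (n + 1) : ℕ) : ℝ) * Real.exp (-(8 * N * (n + 1) * M)) *
    variance (fun g => (ρ g).trace.re) (haarProbability G) with hm
  have hm0 : 0 ≤ m := by
    have : 0 ≤ variance (fun g => (ρ g).trace.re) (haarProbability G) := variance_nonneg _ _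
    rw [hm]; positivity
  have hsum : ∀ j, β j = β 0 + ∑ i ∈ Finset.range j, δ i := by
    intro j
    induction j with
    | zero => simp
    | succ j ih => rw [hstep, ih, Finset.sum_range_succ]; ring
  have hmono : ∀ j ≤ k, ∀ i ≤ j, β i ≤ β j := by
    intro j hj i hij
    rw [hsum i, hsum j, add_le_add_iff_left]
    exact Finset.sum_le_sum_of_subset_of_nonneg (Finset.range_subset_range.2 hij)
      fun l hl _ => hδ l (lt_of_lt_of_le (Finset.mem_range.1 hl) hj)
  have hfloor : ∀ i < k, ∀ u ∈ Icc (β i) (β i + 2 * δ i),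
      m ≤ variance (wilsonAction (d := n + 2) (L := L) ρ) (wilsonMeasure (d := n + 2) (L := L) ρ u) := by
    intro i hi u hu
    refine le_trans ?_ (wilson_variance_ge_extensive (n := n) (L := L) ρ hL hρ u)
    have h1 : β 0 ≤ β i := hmono i hi.le 0 (Nat.zero_le i)
    have h2 : β (i + 1) ≤ β k := hmono k le_rfl (i + 1) hi
    have h3 : β i + δ i = β (i + 1) := (hstep i).symm
    have hu' : |u| ≤ M := by
      rw [abs_le]; constructor <;> linarith [hu.1, hu.2, hD i hi]
    have hv : 0 ≤ variance (fun g => (ρ g).trace.re) (haarProbability G) := variance_nonneg _ _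
    have hN : (0 : ℝ) ≤ 8 * N * (n + 1) := by positivity
    have hexp : Real.exp (-(8 * N * (n + 1) * M)) ≤ Real.exp (-(8 * N * (n + 1) * |u|)) :=
      Real.exp_le_exp.2 (by nlinarith)
    have hE : (0 : ℝ) ≤ ((L * (L / 2) ^ (n + 1) : ℕ) : ℝ) := by positivity
    exact mul_le_mul_of_nonneg_right (mul_le_mul_of_nonneg_left hexp hE) hv
  have h := schedule_sum_ge_of_floors (d := n + 2) (L := L) ρ hρ k β δ (fun _ => m) hδ hfloor
  have hk0 : (0 : ℝ) < k := by exact_mod_cast hk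
  have hcs := Finset.sum_mul_sq_le_sq_mul_sq (Finset.range k) (fun _ => (1 : ℝ)) (fun i => δ i)
  simp only [one_mul, one_pow, Finset.sum_const, Finset.card_range, nsmul_eq_mul, mul_one] at hcs
  have hΔ : β k - β 0 = ∑ i ∈ Finset.range k, δ i := by rw [hsum k]; ring
  have hbound : m * (β k - β 0) ^ 2 / k ≤ ∑ i ∈ Finset.range k, δ i ^ 2 * m := by
    rw [hΔ, div_le_iff₀ hk0, ← Finset.sum_mul]
    nlinarith [hcs, hm0]
  exact hbound.trans h

end Summit.Ventures.LatticeQCDFlow.TrivializingMaps
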